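import Mathlib.Tactic
import Mathlib.Algebra.Order.Floor.Defs
import HarnessLib

/-!
# The size-law constant as the solution of a recursion: the tower chain saturates the one-step induction (DC+) (PROOFS §P71 (e); BENCH M2-R112)

Support file (`--supports stmt-CriticalPhenomena-4575`), prover seat `prim-rate-mine-2` (lane prim-rate, constants-miner (c);
`run/shared/lean/prim/prim-rate/prim-rate-mine-2/PROOFS.md` §P71 (e)).  No definitions, no named facts, no sorries; standard axioms.

SETTING.  The lane's constant is `C(n) = max(0, ⌊(n−2)²/4⌋/(n−2) − 1)`; for `K := n − 2 ≥ 4` this is `c K := ⌊K²/4⌋/K − 1 ≥ 0`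
(written below with natural-number division, `((K^2/4 : ℕ) : ℚ) / K − 1`, exactly as in `CSH.sep_sizeLaw_floor`).  PROOFS §P71 (e) proposes the
ONE-STEP INDUCTION (DC+): «for every graph `G` on `n ≥ 7` vertices some pair `e` satisfies `Φ_{C(n)}(G) ≥ Φ_{C(n)}(G − e) + Φ_{C(n−1)}(G/e)`»,
which implies the antithetic size law (A½) for every `n` by induction on `(n, #pairs)`.  This file proves the arithmetic behind the statement
that the BALANCED HUB–PATH TOWERS saturate (DC+) at EVERY size:

* `CSH.sizeLawConst_recursion` — for `K ≥ 5`:  `(c K − c (K−1))·(K−1) + c K + 1 = ⌊K/2⌋`, i.e. `c K = (⌊K/2⌋ − 1 + (K−1)·c(K−1)) / K`: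
  the constant is the solution of a one-line recursion (parity split `K = 2i+2` / `K = 2i+3`, then `field_simp; ring`).
* `CSH.towerChain_step` — with the TOWER INTEGERS of PROOFS §P68 (k) (`S = K`, `C₀ = K − k_L k_R` for the tower `(k_L,k_R)`, `K = k_L + k_R`)
  and the two exact peeling facts of `…QuantitativeAntitheticArmPeeling` (`Φ(G − e) = 0` for the end pair `e` of an arm, `Φ(G/e) = Φ` of the
  tower one shorter), the (DC+) margin of the tower at the end pair of the arm of length `k_L` is
  `2·[(K − k_Lk_R + c K·K) − ((K−1) − (k_L−1)k_R + c(K−1)·(K−1))] = 2·(⌊K/2⌋ − k_R)` — non-negative iff the OTHER arm is the shorter one,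
  ZERO iff the tower is balanced: every step of the induction along the chain of balanced towers is tight (`CSH.towerChain_step_nonneg`,
  `CSH.towerChain_step_eq_zero`).
* `CSH.dcplus_step` — the bookkeeping of one induction step: the one-pair identity `Φₙ(G) = Φₙ(G−e) + Φₙ(G/e) − Δ`, the C-linearity
  `Φₙ(G/e) = Φₙ₋₁(G/e) + 2(cₙ − cₙ₋₁)·S(G/e)`, the two induction hypotheses and the KEY INEQUALITY `Δ ≤ 2(cₙ − cₙ₋₁)·S(G/e)` give `Φₙ(G) ≥ 0`.
ADDENDUM (same session, appended): `CSH.sizeLawConst_delta_lt_third` — the slack per step is small, `0 ≤ c K − c (K−1) < 1/3` for `K ≥ 5`;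
`CSH.dcplus_armSide_margin_nonneg` — the arithmetic of PROOFS §P71 (h) «a hub–path ARM of length k against an ARBITRARY side»: with the
antithetic side counts `λ, φ, ν` of the other side (`λ, ν ≥ 0`, `φ ≤ κ·λ` by the component-size one-side lemma (aK4b′), PROOFS §P71 (g), `κ ≤ r`)
the (DC+) margin at the arm's end pair, `λ(1 + c + Δ(k−1)) − φ(1 − Δ) + Δ·ν` (`Δ = c K − c(K−1)`, `K = k + r`), is `≥ 0` whenever `k ≥ κ + 1`:
(DC+) holds on this whole infinite class of separator graphs (the towers are the case `r = κ`).
[cite: VandenbergHaggstromKahn2005, Thm. 1.3 (p. 6)] [cite: Harris1960, Lemma 4.1 (p. 16)]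
-/

namespace Summit.CriticalPhenomena.PercolationContinuityZ3.Theorems.CSH

/-- **The size-law constant solves a one-line recursion** (PROOFS §P71 (e)(i)): with `c K = ⌊K²/4⌋/K − 1` (natural-number division),
for every `K ≥ 5`: `(c K − c (K−1))·(K − 1) + c K + 1 = ⌊K/2⌋`.  (`K = n − 2`; this is `(C(n) − C(n−1))(n−3) + C(n) + 1 = ⌊(n−2)/2⌋` for
`n ≥ 7`; it FAILS at `n = 6`, where `C(6) = C(5) = 0` — the reason (DC+) starts at `n = 7`.) [cite: VandenbergHaggstromKahn2005, Thm. 1.3 (p. 6)] -/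
theorem sizeLawConst_recursion (K : ℕ) (hK : 5 ≤ K) :
    ((((K ^ 2 / 4 : ℕ) : ℚ) / K - 1) - ((((K - 1) ^ 2 / 4 : ℕ) : ℚ) / ((K - 1 : ℕ) : ℚ) - 1)) * ((K - 1 : ℕ) : ℚ)
        + ((((K ^ 2 / 4 : ℕ) : ℚ) / K - 1) + 1) = ((K / 2 : ℕ) : ℚ) := by
  obtain ⟨j, hj | hj⟩ := Nat.even_or_odd' K
  · -- K = 2j, j ≥ 3; write j = i + 1
    obtain ⟨i, rfl⟩ : ∃ i, j = i + 1 := ⟨j - 1, by omega⟩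
    subst hj
    have h1 : (2 * (i + 1)) ^ 2 / 4 = (i + 1) ^ 2 := by
      rw [show (2 * (i + 1)) ^ 2 = (i + 1) ^ 2 * 4 by ring]; exact Nat.mul_div_cancel _ (by norm_num)
    have h2 : (2 * (i + 1) - 1) ^ 2 / 4 = i ^ 2 + i := by
      rw [show 2 * (i + 1) - 1 = 2 * i + 1 by omega, show (2 * i + 1) ^ 2 = 1 + (i ^ 2 + i) * 4 by ring,
        Nat.add_mul_div_right _ _ (by norm_num)]
      simp
    have h3 : 2 * (i + 1) / 2 = i + 1 := by omega
    have h4 : ((2 * (i + 1) - 1 : ℕ) : ℚ) = 2 * i + 1 := by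
      rw [show 2 * (i + 1) - 1 = 2 * i + 1 by omega]; push_cast; ring
    rw [h1, h2, h3, h4]
    push_cast
    have hne1 : (2 * ((i : ℚ) + 1)) ≠ 0 := by positivity
    have hne2 : (2 * (i : ℚ) + 1) ≠ 0 := by positivity
    field_simp
    ring
  · -- K = 2j+1, j ≥ 2; write j = i + 1
    obtain ⟨i, rfl⟩ : ∃ i, j = i + 1 := ⟨j - 1, by omega⟩
    subst hj
    have h1 : (2 * (i + 1) + 1) ^ 2 / 4 = i ^ 2 + 3 * i + 2 := by
      rw [show (2 * (i + 1) + 1) ^ 2 = 1 + (i ^ 2 + 3 * i + 2) * 4 by ring, Nat.add_mul_div_right _ _ (by norm_num)]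
      simp
    have h2 : (2 * (i + 1) + 1 - 1) ^ 2 / 4 = (i + 1) ^ 2 := by
      rw [show 2 * (i + 1) + 1 - 1 = 2 * (i + 1) by omega, show (2 * (i + 1)) ^ 2 = (i + 1) ^ 2 * 4 by ring]
      exact Nat.mul_div_cancel _ (by norm_num)
    have h3 : (2 * (i + 1) + 1) / 2 = i + 1 := by omega
    have h4 : ((2 * (i + 1) + 1 - 1 : ℕ) : ℚ) = 2 * i + 2 := by
      rw [show 2 * (i + 1) + 1 - 1 = 2 * (i + 1) by omega]; push_cast; ring
    rw [h1, h2, h3, h4]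
    push_cast
    have hne1 : (2 * ((i : ℚ) + 1) + 1) ≠ 0 := by positivity
    have hne2 : (2 * (i : ℚ) + 2) ≠ 0 := by positivity
    field_simp
    ring

/-- **The tower chain step** (PROOFS §P71 (e)(ii)).  For the hub–path tower `(k_L, k_R)` (`K = k_L + k_R ≥ 5`, i.e. `n = K + 2 ≥ 7`) the
tower integers are `S = K`, `C₀ = K − k_L k_R` (PROOFS §P68 (k)); peeling the end pair `e` of the arm of length `k_L` gives `Φ(G − e) = 0` and
`G/e ≅` the tower `(k_L − 1, k_R)`, so the (DC+) margin `Φ_{c K}(G) − Φ_{c K}(G − e) − Φ_{c(K−1)}(G/e)` equals (in units of `C₀ + c·S`, times 2)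
`2·(⌊K/2⌋ − k_R)`. [cite: VandenbergHaggstromKahn2005, Thm. 1.3 (p. 6)] -/
theorem towerChain_step (K kL kR : ℕ) (hK : 5 ≤ K) (hsum : kL + kR = K) (hkL : 1 ≤ kL) :
    2 * ((((K : ℚ) - kL * kR) + (((K ^ 2 / 4 : ℕ) : ℚ) / K - 1) * K)
        - (((((K - 1 : ℕ) : ℚ)) - (((kL - 1 : ℕ) : ℚ)) * kR) + ((((K - 1) ^ 2 / 4 : ℕ) : ℚ) / ((K - 1 : ℕ) : ℚ) - 1) * ((K - 1 : ℕ) : ℚ)))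
      = 2 * (((K / 2 : ℕ) : ℚ) - kR) := by
  have hrec := sizeLawConst_recursion K hK
  have hkL' : ((kL - 1 : ℕ) : ℚ) = kL - 1 := by rw [Nat.cast_sub hkL]; push_cast; ring
  have hK1 : ((K - 1 : ℕ) : ℚ) = K - 1 := by rw [Nat.cast_sub (by omega : 1 ≤ K)]; push_cast; ring
  have hKq : (kL : ℚ) = K - kR := by
    have : ((kL + kR : ℕ) : ℚ) = K := by rw [hsum]
    push_cast at this; linarith
  rw [hK1] at hrec
  rw [hK1, hkL', hKq]
  -- with X := ⌊K²/4⌋/K − 1 and Y := ⌊(K−1)²/4⌋/(K−1) − 1:  hrec : (X − Y)(K−1) + X + 1 = ⌊K/2⌋,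
  -- goal : 2[(K − k_Lk_R + X·K) − ((K−1) − (k_L−1)k_R + Y·(K−1))] = 2(⌊K/2⌋ − k_R)
  linear_combination 2 * hrec

/-- **Corollary: peel the LONGER arm.**  If the other arm is the shorter one (`k_R ≤ ⌊K/2⌋`) the tower satisfies (DC+) at that pair; with equality
iff `k_R = ⌊K/2⌋` (balanced tower) — `CSH.towerChain_step_eq_zero`. [cite: VandenbergHaggstromKahn2005, Thm. 1.3 (p. 6)] -/
theorem towerChain_step_nonneg (K kL kR : ℕ) (hK : 5 ≤ K) (hsum : kL + kR = K) (hkL : 1 ≤ kL) (hshort : kR ≤ K / 2) :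
    0 ≤ 2 * ((((K : ℚ) - kL * kR) + (((K ^ 2 / 4 : ℕ) : ℚ) / K - 1) * K)
        - (((((K - 1 : ℕ) : ℚ)) - (((kL - 1 : ℕ) : ℚ)) * kR) + ((((K - 1) ^ 2 / 4 : ℕ) : ℚ) / ((K - 1 : ℕ) : ℚ) - 1) * ((K - 1 : ℕ) : ℚ))) := by
  rw [towerChain_step K kL kR hK hsum hkL]
  have : (kR : ℚ) ≤ ((K / 2 : ℕ) : ℚ) := by exact_mod_cast hshort
  linarith

/-- **The balanced tower is tight at every size**: for `k_R = ⌊K/2⌋` the (DC+) margin at the end pair of the longer arm is exactly `0`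
(PROOFS §P71 (e)(ii)). [cite: VandenbergHaggstromKahn2005, Thm. 1.3 (p. 6)] -/
theorem towerChain_step_eq_zero (K kL kR : ℕ) (hK : 5 ≤ K) (hsum : kL + kR = K) (hkL : 1 ≤ kL) (hbal : kR = K / 2) :
    2 * ((((K : ℚ) - kL * kR) + (((K ^ 2 / 4 : ℕ) : ℚ) / K - 1) * K)
        - (((((K - 1 : ℕ) : ℚ)) - (((kL - 1 : ℕ) : ℚ)) * kR) + ((((K - 1) ^ 2 / 4 : ℕ) : ℚ) / ((K - 1 : ℕ) : ℚ) - 1) * ((K - 1 : ℕ) : ℚ))) = 0 := by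
  rw [towerChain_step K kL kR hK hsum hkL, hbal]; ring

/-- **One step of the (DC+) induction** (PROOFS §P71 (e), THEOREM (DC+) ⟹ (A½)): from the one-pair identity `Φₙ(G) = Φₙ(G−e) + Φₙ(G/e) − Δ`,
the linearity in the constant `Φₙ(G/e) = Φₙ₋₁(G/e) + 2(cₙ − cₙ₋₁)·S'` (`S' = S(G/e)`), the induction hypotheses `Φₙ(G−e) ≥ 0`, `Φₙ₋₁(G/e) ≥ 0`
and the KEY INEQUALITY `Δ ≤ 2(cₙ − cₙ₋₁)·S'`, conclude `Φₙ(G) ≥ 0`. [cite: Harris1960, Lemma 4.1 (p. 16)] -/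
theorem dcplus_step (ΦG ΦGe ΦnGc Φn1Gc Δ S' cn cn1 : ℚ)
    (hpair : ΦG = ΦGe + ΦnGc - Δ) (hlin : ΦnGc = Φn1Gc + 2 * (cn - cn1) * S')
    (hdel : 0 ≤ ΦGe) (hcon : 0 ≤ Φn1Gc) (hkey : Δ ≤ 2 * (cn - cn1) * S') :
    0 ≤ ΦG := by
  rw [hpair, hlin]; linarith

/-- **The slack per step is less than a third** (PROOFS §P71 (h)(iii)): for `K ≥ 5`, `0 ≤ c K − c (K−1) < 1/3`
(`c K = ⌊K²/4⌋/K − 1`; the difference is `j/(2(2j−1))` for `K = 2j` and `j/(2(2j+1))` for `K = 2j+1`). [cite: VandenbergHaggstromKahn2005, Thm. 1.3 (p. 6)] -/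
theorem sizeLawConst_delta_lt_third (K : ℕ) (hK : 5 ≤ K) :
    0 ≤ ((((K ^ 2 / 4 : ℕ) : ℚ) / K - 1) - ((((K - 1) ^ 2 / 4 : ℕ) : ℚ) / ((K - 1 : ℕ) : ℚ) - 1)) ∧
    ((((K ^ 2 / 4 : ℕ) : ℚ) / K - 1) - ((((K - 1) ^ 2 / 4 : ℕ) : ℚ) / ((K - 1 : ℕ) : ℚ) - 1)) < 1 / 3 := by
  obtain ⟨j, hj | hj⟩ := Nat.even_or_odd' K
  · obtain ⟨i, rfl⟩ : ∃ i, j = i + 1 := ⟨j - 1, by omega⟩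
    subst hj
    have hi : (2 : ℚ) ≤ i := by exact_mod_cast (show 2 ≤ i by omega)
    have h1 : (2 * (i + 1)) ^ 2 / 4 = (i + 1) ^ 2 := by
      rw [show (2 * (i + 1)) ^ 2 = (i + 1) ^ 2 * 4 by ring]; exact Nat.mul_div_cancel _ (by norm_num)
    have h2 : (2 * (i + 1) - 1) ^ 2 / 4 = i ^ 2 + i := by
      rw [show 2 * (i + 1) - 1 = 2 * i + 1 by omega, show (2 * i + 1) ^ 2 = 1 + (i ^ 2 + i) * 4 by ring,
        Nat.add_mul_div_right _ _ (by norm_num)]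
      simp
    have h4 : ((2 * (i + 1) - 1 : ℕ) : ℚ) = 2 * i + 1 := by
      rw [show 2 * (i + 1) - 1 = 2 * i + 1 by omega]; push_cast; ring
    rw [h1, h2, h4]
    push_cast
    have hne1 : (0 : ℚ) < 2 * ((i : ℚ) + 1) := by positivity
    have hne2 : (0 : ℚ) < 2 * (i : ℚ) + 1 := by positivity
    constructor
    · rw [sub_nonneg, sub_le_sub_iff_right, div_le_div_iff₀ hne2 hne1]; nlinarith
    · have key : ((((i:ℚ) + 1) ^ 2) / (2 * ((i : ℚ) + 1)) - 1) - (((i : ℚ) ^ 2 + i) / (2 * (i : ℚ) + 1) - 1)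
          = ((i : ℚ) + 1) / (2 * (2 * (i : ℚ) + 1)) := by
        field_simp; ring
      rw [key, div_lt_div_iff₀ (by positivity) (by norm_num)]; nlinarith
  · obtain ⟨i, rfl⟩ : ∃ i, j = i + 1 := ⟨j - 1, by omega⟩
    subst hj
    have hi : (1 : ℚ) ≤ i := by exact_mod_cast (show 1 ≤ i by omega)
    have h1 : (2 * (i + 1) + 1) ^ 2 / 4 = i ^ 2 + 3 * i + 2 := by
      rw [show (2 * (i + 1) + 1) ^ 2 = 1 + (i ^ 2 + 3 * i + 2) * 4 by ring, Nat.add_mul_div_right _ _ (by norm_num)]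
      simp
    have h2 : (2 * (i + 1) + 1 - 1) ^ 2 / 4 = (i + 1) ^ 2 := by
      rw [show 2 * (i + 1) + 1 - 1 = 2 * (i + 1) by omega, show (2 * (i + 1)) ^ 2 = (i + 1) ^ 2 * 4 by ring]
      exact Nat.mul_div_cancel _ (by norm_num)
    have h4 : ((2 * (i + 1) + 1 - 1 : ℕ) : ℚ) = 2 * i + 2 := by
      rw [show 2 * (i + 1) + 1 - 1 = 2 * (i + 1) by omega]; push_cast; ring
    rw [h1, h2, h4]
    push_cast
    have hne1 : (0 : ℚ) < 2 * ((i : ℚ) + 1) + 1 := by positivity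
    have hne2 : (0 : ℚ) < 2 * (i : ℚ) + 2 := by positivity
    constructor
    · rw [sub_nonneg, sub_le_sub_iff_right, div_le_div_iff₀ hne2 hne1]; nlinarith
    · have key : ((((i : ℚ) ^ 2 + 3 * i + 2) / (2 * ((i : ℚ) + 1) + 1) - 1) - ((((i : ℚ) + 1) ^ 2) / (2 * (i : ℚ) + 2) - 1))
          = ((i : ℚ) + 1) / (2 * (2 * ((i : ℚ) + 1) + 1)) := by
        field_simp; ring
      rw [key, div_lt_div_iff₀ (by positivity) (by norm_num)]; nlinarith

/-- **(DC+) for a hub–path arm against an arbitrary side — the arithmetic** (PROOFS §P71 (h)(ii),(iii)).  Let `K = k + r ≥ 5`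
(`n = K + 2 ≥ 7`), `c = c K`, `Δ = c K − c (K−1)`; let `λ, ν ≥ 0`, `φ ≤ κ·λ` (the component-size one-side lemma (aK4b′) for the other side,
whose `u`-component has `κ ≤ r` vertices).  If the arm is longer than that component, `k ≥ κ + 1`, then the (DC+) margin of PROOFS §P71 (h)(ii),
`λ·(1 + c + Δ·(k−1)) − φ·(1 − Δ) + Δ·ν`, is non-negative. [cite: VandenbergHaggstromKahn2005, Thm. 1.3 (p. 6)] -/
theorem dcplus_armSide_margin_nonneg (K k r κ : ℕ) (hK : 5 ≤ K) (hsum : k + r = K) (hκr : κ ≤ r) (hkκ : κ + 1 ≤ k)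
    (lam φ ν : ℚ) (hlam : 0 ≤ lam) (hν : 0 ≤ ν) (hφ : φ ≤ κ * lam) :
    0 ≤ lam * (1 + ((((K ^ 2 / 4 : ℕ) : ℚ) / K - 1))
          + ((((K ^ 2 / 4 : ℕ) : ℚ) / K - 1) - ((((K - 1) ^ 2 / 4 : ℕ) : ℚ) / ((K - 1 : ℕ) : ℚ) - 1)) * ((k : ℚ) - 1))
        - φ * (1 - ((((K ^ 2 / 4 : ℕ) : ℚ) / K - 1) - ((((K - 1) ^ 2 / 4 : ℕ) : ℚ) / ((K - 1 : ℕ) : ℚ) - 1)))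
        + ((((K ^ 2 / 4 : ℕ) : ℚ) / K - 1) - ((((K - 1) ^ 2 / 4 : ℕ) : ℚ) / ((K - 1 : ℕ) : ℚ) - 1)) * ν := by
  have hrec := sizeLawConst_recursion K hK
  obtain ⟨hΔ0, hΔ3⟩ := sizeLawConst_delta_lt_third K hK
  have hK1 : ((K - 1 : ℕ) : ℚ) = K - 1 := by rw [Nat.cast_sub (by omega : 1 ≤ K)]; push_cast; ring
  rw [hK1] at hrec hΔ0 hΔ3 ⊢
  set c : ℚ := (((K ^ 2 / 4 : ℕ) : ℚ) / K - 1) with hc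
  set Δ : ℚ := c - ((((K - 1) ^ 2 / 4 : ℕ) : ℚ) / ((K : ℚ) - 1) - 1) with hΔ
  -- hrec : Δ * (K - 1) + (c + 1) = ⌊K/2⌋ ;  ⌊K/2⌋ ≥ (K-1)/2
  have hfloor : ((K : ℚ) - 1) / 2 ≤ ((K / 2 : ℕ) : ℚ) := by
    have h : K ≤ 2 * (K / 2) + 1 := by omega
    have : (K : ℚ) ≤ 2 * ((K / 2 : ℕ) : ℚ) + 1 := by exact_mod_cast h
    linarith
  have hKq : (K : ℚ) = k + r := by rw [← hsum]; push_cast; ring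
  have hkκq : (κ : ℚ) + 1 ≤ k := by exact_mod_cast hkκ
  have hκrq : (κ : ℚ) ≤ r := by exact_mod_cast hκr
  -- φ(1-Δ) ≤ κ λ (1-Δ)
  have h1Δ : 0 ≤ 1 - Δ := by linarith
  have hφ' : φ * (1 - Δ) ≤ κ * lam * (1 - Δ) := mul_le_mul_of_nonneg_right hφ h1Δ
  -- main: λ(1 + c + Δ(k-1)) - κλ(1-Δ) + Δν ≥ 0 ; using 1 + c = ⌊K/2⌋ - Δ(K-1) ≥ (K-1)/2 - Δ(K-1)
  have hΔν : 0 ≤ Δ * ν := mul_nonneg hΔ0 hν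
  have hcore : 0 ≤ 1 + c + Δ * ((k : ℚ) - 1) - κ * (1 - Δ) := by
    have e1 : 1 + c = ((K / 2 : ℕ) : ℚ) - Δ * ((K : ℚ) - 1) := by linarith
    rw [e1, hKq]
    rw [hKq] at hfloor
    -- ⌊K/2⌋ - Δ(k+r-1) + Δ(k-1) - κ + κΔ = ⌊K/2⌋ - κ - Δ(r-κ) ≥ (k+r-1)/2 - κ - (r-κ)/3 ≥ 0 when k ≥ κ+1
    nlinarith [hΔ0, hΔ3, hkκq, hκrq, hfloor]
  have : 0 ≤ lam * (1 + c + Δ * ((k : ℚ) - 1) - κ * (1 - Δ)) := mul_nonneg hlam hcore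
  nlinarith [this, hφ', hΔν]


end Summit.CriticalPhenomena.PercolationContinuityZ3.Theorems.CSH
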